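/-
Copyright (c) 2026 the pub-hodgecm-mathlib formalisation cell (harness21).  Prover seat hodgecm-mathlib-F0P3a-p01 (g32), req620 Track A «(D-RAM) FOUR-FRAME» squad
(unit U3_Laws, (KMS) road «MODULO κ-STAGE B», brick κB-T tv = 2 TWIN «T-STRATA κ-SOCKETS, TYPE 2», FILE 2₂∕3₂: THE SIGNED κ-COUNT OF THE TYPE-2 SPLIT LATTICES;
dealer LH4-plan (g11) WORD #44 (1); head letters F0P3a-p01 (g32) 2026-09-04T02:00:51Z; type-0 template ★ `F0P3cDyRamDiagonalKappaSplitCountValues` (LH4-p04 (g2)) VERBATIM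
up to the parity of `s` and the window).  2026-09-04.
-/
import Summits.HodgeConjecture.HodgeConjecture.Theorems.F0P3cDyRamDiagonalKappaSplitCountTwoEval   -- FILE 1₂ (this seat): `isVertexLattice_two_latt_axis1∕2∕3` (explicit type-2 polarisations); brings everything below
import Summits.HodgeConjecture.HodgeConjecture.Theorems.F0P3cDyRamDiagonalKappaSplitCountEval      -- ★ κB-T FILE 1 (LH4-p04): `chiVec_zero∕one∕two`, `normSign_mul_self`, `normSign_normVarpi_pow_inv`, `normSign_neg_polarisation_entry`; brings ★ Fκ2∕Fκ1 (LH4-p05: `kappaCount_eq_cosetKappa_of_hcoset`, `cosetKappa_coset_eq_of_dichotomy`), ★ B4 (S_F of the split lattices), ★ LocalFields (`exists_fixed_unit_not_norm_of_level_pow`, `normSign_eq_of_near`, `isAdicComplete_valuedInteger_of_completeSpace`, `exists_nonnorm_dichotomy_of_isRamifiedQuadraticDatum`)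
import Summits.HodgeConjecture.HodgeConjecture.Theorems.F0P3cDyRamDiagonalSplitCountTwoUnique      -- ★ B9-0₂ (LH4-p13): `typeTwoPolarisation_unique_latt_axis3` (one `S_F`-coset of type-2 polarisations on `M₃(s,x)`)
import Summits.HodgeConjecture.HodgeConjecture.Theorems.F0P3cDyRamDiagonalSplitCountTwoUniqueAxisOne   -- ★ B9-0₂ (LH4-p13): `typeTwoPolarisation_unique_latt_axis1`
import Summits.HodgeConjecture.HodgeConjecture.Theorems.F0P3cDyRamDiagonalSplitCountTwoUniqueAxisTwo   -- ★ B9-0₂ (LH4-p13): `typeTwoPolarisation_unique_latt_axis2`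
import Summits.HodgeConjecture.HodgeConjecture.Theorems.F0P3cDyRamDiagonalSplitCountTwoTools       -- ★ B4₂ FILE 1 (LH4-p13): `isVertexLattice_two_of_gram_eq_block₁∕₂∕₃`
import Summits.HodgeConjecture.HodgeConjecture.Theorems.F0P3cDyRamDiagonalPolarisationCoset        -- ★ (3b) (LH4-p11): `isVertexLattice_diagonal_iff_of_unique` (uniqueness ⇒ the `hcoset` shape)
import HarnessLib

/-!
# Crux `H413`, line LH4 «(D-RAM) FOUR-FRAME» road — unit U3_Laws (iii), (KMS) road «MODULO κ-STAGE B», brick κB-T tv = 2 TWIN, FILE 2₂∕3₂: THE SIGNED κ-COUNT OF THE TYPE-2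
# SPLIT (ON-BRANCH) LATTICES `kappaCount σ ϖ 2 i (M_k(s,·)) = ω(−1)·[i = foot]·[s + 1 ≥ 2d]` (`s` odd)

Cell `hodgecm-mathlib` (D-0151), FLOOR 0, crux item H413 = `stmt-HodgeConjecture-24833`, route of record `HCCMUnconditional`; squad F0∕P3c∕LH4 (req618∕req620); registered stub served:
`F0P3cDyRamFourFrameU3.stub_U3_kappaModelSum` (KMS; tree `Cruxes/H413/Lines/F0_P3c_DyRamFourFrame_U3_Laws.lean` ED. 8 :457), type-2 half (`hBκ10₂`: `kappaCount σ ϖ 2` over the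
type-2-polarisable part of `𝓛₀(T)`).  THEOREMS ONLY (no `def`, no instance, no notation, no `sorry`, default heartbeats); lane `--supports stmt-HodgeConjecture-24833 --as helper`
(count-neutral).  FILE 3₂ `…DiagonalKappaSplitCountTwoSockets` sums these values over the three type-2 T-strata `stratumTwo σ ϖ T (s,s,0)∕(0,s,s)∕(s,0,s)` (★ StrataDefs ED. 2).

THE MATHEMATICS (LH4-p05 (g3) PLAN v1 §4 «on-branch», type-2 column = the type-0 file's argument with ONE change).  For ODD `s = 2j+1` and a unit `x`, `M₃(s,x) =
latt (1 0 0; x ϖ^s 0; 0 0 1)` is a type-2 vertex lattice for `D₁ = (−xσx·π₀^{−j}, π₀^{−j}, 1)`, `π₀ = ϖσϖ` (★ B4₂ (T₃²·a), re-exported with `D₁` explicit); its type-2 polarisations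
are ONE `S_F`-coset (★ B9-0₂), so ★ Fκ2 gives `kappaCount σ ϖ 2 i M₃ = χ_i(D₁)·[χ_i ≡ 1 on S_F]` under the index-two dichotomy (non-norm unit `c`, complete `K`), with
`S_F(M₃) = {u ∈ 𝒰^σ : |u₁ − u₀| ≤ |ϖ^s|}` (★ B4).  THE CHANGE: `u₁∕u₀` is `σ`-fixed, so `|u₁∕u₀ − 1| ≤ |ϖ|^s` with `s` odd means `≤ |ϖ|^{s+1}`: (ALIVE) `2d ≤ s + 1` ⇒ `ω(u₁) = ω(u₀)`
on `S_F` (★ `normSign_eq_of_near`, hypothesis `2d − 1 ≤ s`) ⇒ `κ_2 = χ_2(D₁) = ω(−1)`; (DEAD FOOT) `s + 3 ≤ 2d` ⇒ the level-`(j+1)` fixed non-norm `u₀` (★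
`exists_fixed_unit_not_norm_of_level_pow`, `|u₀ − 1| ≤ |ϖ|^{2j+2} ≤ |ϖ|^s`) puts `(1, u₀, 1) ∈ S_F` with `χ_2 = −1` ⇒ `κ_2 = 0`; (DEAD OFF-FOOT) `(1,1,c) ∈ S_F`, `χ_0 = χ_1 = ω(c) = −1`.
Axes 1, 2: slots permuted (★ B4₂ (T₁²·a)∕(T₂²·a)).  No type-2 core (`𝒪³` is not type-2 polarisable; B10₂ has no core cell).

WHAT IS PROVED (generic complete valued field with finite residue field; `K : Type` as in ★ `normSign`).  §0 `isVertexLattice_two_latt_axis1∕2∕3` (the explicit type-2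
polarisations — the witnesses of ★ `isTypeTwoPolarisable_latt_axisN`, proofs verbatim).  §1 `kappaCount_two_latt_axis1∕2∕3` (the three values, window `2 * d ≤ s + 1`).
HONEST LABEL.  Count-neutral (`--supports`); nothing printed is asserted; (KMS) stays a PROVER TARGET (empirical census law in diagonal-model currency); `HC_CM` is proved only modulo
the 7 printed citations (2 remaining named inputs: hLiu418 = `stmt-HodgeConjecture-24832`, h413 = `stmt-HodgeConjecture-24833`) until rung 0 closes.

## References
* [Kottwitz1986BaseChangeUnits] R. E. Kottwitz, *Base change for unit elements of Hecke algebras*, Compositio Math. 60 (1986), §1 pp. 240–241 (κ-orbital integrals of units as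
  signed lattice counts modulo the torus).
* [Rogawski1990] J. D. Rogawski, *Automorphic Representations of Unitary Groups in Three Variables*, Ann. of Math. Stud. 123 (1990), §4.9 Prop. 4.9.1 (a) p. 55, §4.10 p. 58.
* [Serre1979] J.-P. Serre, *Local Fields*, GTM 67 (1979), Ch. V §3 Prop. 5, Cor. 3 (norms on the unit filtration; the conductor of a ramified quadratic extension).
* [Jacobowitz1962] R. Jacobowitz, *Hermitian forms over local fields*, Amer. J. Math. 84 (1962), §7–§8 (`𝔭`-modular lattices, Gram matrices).
-/

set_option autoImplicit false

noncomputable section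

namespace Summit.HodgeConjecture.HodgeConjecture.Cruxes.H413.F0P3cDyRamDiagonalKappaSplitCountTwoValues

open Matrix
open Literature.NumberTheory.Automorphic Literature.NumberTheory.Automorphic.HermitianLattice
open Literature.NumberTheory.Automorphic.UnitaryLatticeTree Literature.NumberTheory.Automorphic.UnitaryThreeFourFrame
open Literature.NumberTheory.LocalFields Literature.NumberTheory.LocalFields.WildQuadraticDatum
open Summit.HodgeConjecture.HodgeConjecture.Cruxes.H413.F0P3cDyRamDiagonalTorusDefs
open Summit.HodgeConjecture.HodgeConjecture.Cruxes.H413.F0P3cDyRamDiagonalStrataDefs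
open Summit.HodgeConjecture.HodgeConjecture.Cruxes.H413.F0P3cDyRamDiagonalKappaCountDefs
open Summit.HodgeConjecture.HodgeConjecture.Cruxes.H413.F0P3cDyRamDiagonalKappaCountEval
open Summit.HodgeConjecture.HodgeConjecture.Cruxes.H413.F0P3cDyRamStableSumSignClasses (normSign_eq_one_or)
open Summit.HodgeConjecture.HodgeConjecture.Cruxes.H413.F0P3cDyRamFixedCountDiagonalModel (normSign_mul_norm)
open Summit.HodgeConjecture.HodgeConjecture.Cruxes.H413.F0P3cDyRamDiagonalStratumTools
open Summit.HodgeConjecture.HodgeConjecture.Cruxes.H413.F0P3cDyRamDiagonalGluedTubeCriterion (formCongr_hnf_diagonal)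
open Summit.HodgeConjecture.HodgeConjecture.Cruxes.H413.F0P3cDyRamDiagonalCoreUnique
open Summit.HodgeConjecture.HodgeConjecture.Cruxes.H413.F0P3cDyRamDiagonalSplitCount
open Summit.HodgeConjecture.HodgeConjecture.Cruxes.H413.F0P3cDyRamDiagonalSplitCountAxisOne
open Summit.HodgeConjecture.HodgeConjecture.Cruxes.H413.F0P3cDyRamDiagonalSplitCountAxisTwo
open Summit.HodgeConjecture.HodgeConjecture.Cruxes.H413.F0P3cDyRamDiagonalSplitCountTwoTools
open Summit.HodgeConjecture.HodgeConjecture.Cruxes.H413.F0P3cDyRamDiagonalSplitCountTwoUnique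
open Summit.HodgeConjecture.HodgeConjecture.Cruxes.H413.F0P3cDyRamDiagonalSplitCountTwoUniqueAxisOne
open Summit.HodgeConjecture.HodgeConjecture.Cruxes.H413.F0P3cDyRamDiagonalSplitCountTwoUniqueAxisTwo
open Summit.HodgeConjecture.HodgeConjecture.Cruxes.H413.F0P3cDyRamDiagonalPolarisationCoset (isVertexLattice_diagonal_iff_of_unique)
open Summit.HodgeConjecture.HodgeConjecture.Cruxes.H413.F0P3cDyRamDiagonalKappaSplitCountEval
open Summit.HodgeConjecture.HodgeConjecture.Cruxes.H413.F0P3cDyRamDiagonalKappaSplitCountTwoEval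
open scoped Valued WithZero Matrix MatrixGroups

variable {K : Type} [Field K] [Valued K ℤᵐ⁰]

/-! ## §1  The type-2 κ-count of the three split lattices -/

/-- **AXIS 1 (plane `⟨e₁,e₂⟩`, foot index `0`), TYPE 2**: for `|z| = 1` and ODD `s`, `kappaCount σ ϖ 2 i (M₁(s,z)) = ω(−1)` if `i = 0 ∧ 2d ≤ s + 1`, and `0` otherwise
(one `S_F`-coset ★ B9-0₂; ALIVE by deep norms at F-level `(s+1)∕2 ≥ d`, DEAD FOOT by the level-`(s+1)∕2` non-norm, DEAD OFF-FOOT by the non-norm `c` in an off-foot slot).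
[cite: Kottwitz1986BaseChangeUnits, §1 pp. 240–241] [cite: Serre1979, Ch. V §3 Prop. 5, Cor. 3] [cite: Rogawski1990, §4.10 p. 58] -/
theorem kappaCount_two_latt_axis1 [CompleteSpace K] [Finite 𝓀[K]] {σ : K →+* K} {ϖ : K} {d t : ℕ} (hD : IsRamifiedQuadraticDatum σ ϖ d t)
    {z : K} (hz : Valued.v z = 1) {s : ℕ} (hs : ¬ 2 ∣ s) (i : Fin 3) :
    kappaCount σ ϖ 2 i (latt (!![1, 0, 0; 0, 1, 0; 0, z, ϖ ^ s] : Matrix (Fin 3) (Fin 3) K)) = if i = 0 ∧ 2 * d ≤ s + 1 then normSign σ (-1 : K) else 0 := by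
  have hD' := hD
  obtain ⟨hσ, hvσ, hϖ, hfix, -, -, -⟩ := hD'
  haveI : IsAdicComplete 𝓂[K] 𝒪[K] := isAdicComplete_valuedInteger_of_completeSpace hϖ
  obtain ⟨c, hσc, hcv, hc, hdich⟩ := exists_nonnorm_dichotomy_of_isRamifiedQuadraticDatum σ ϖ d t hD
  obtain ⟨j, rfl⟩ : ∃ j, s = 2 * j + 1 := ⟨s / 2, by omega⟩
  have hϖ0 : ϖ ≠ 0 := fun h0 => by rw [h0, map_zero] at hϖ; exact WithZero.coe_ne_zero hϖ.symm
  have hϖ1 : Valued.v ϖ ≤ 1 := by rw [hϖ, ← WithZero.exp_zero, WithZero.exp_le_exp]; norm_num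
  have hσϖ0 : σ ϖ ≠ 0 := (map_ne_zero σ).2 hϖ0
  have hz0 : z ≠ 0 := fun h => by rw [h, map_zero] at hz; exact zero_ne_one hz
  have hc0 : c ≠ 0 := fun h => by rw [h, map_zero] at hcv; exact zero_ne_one hcv
  have hπ₀σ : σ (ϖ * σ ϖ) = ϖ * σ ϖ := by rw [map_mul, hσ, mul_comm]
  have hd₁σ : σ (((ϖ * σ ϖ) ^ j)⁻¹) = ((ϖ * σ ϖ) ^ j)⁻¹ := by rw [map_inv₀, map_pow, hπ₀σ]
  have hd₁0 : (((ϖ * σ ϖ) ^ j)⁻¹ : K) ≠ 0 := inv_ne_zero (pow_ne_zero _ (mul_ne_zero hϖ0 hσϖ0))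
  have hD₁ : ∀ k : Fin 3, σ ((![1, -(σ z * ((ϖ * σ ϖ) ^ j)⁻¹ * z), ((ϖ * σ ϖ) ^ j)⁻¹] : Fin 3 → K) k) = (![1, -(σ z * ((ϖ * σ ϖ) ^ j)⁻¹ * z), ((ϖ * σ ϖ) ^ j)⁻¹] : Fin 3 → K) k ∧ (![1, -(σ z * ((ϖ * σ ϖ) ^ j)⁻¹ * z), ((ϖ * σ ϖ) ^ j)⁻¹] : Fin 3 → K) k ≠ 0 := by
    intro k
    fin_cases k
    · exact ⟨map_one σ, one_ne_zero⟩
    · refine ⟨?_, ?_⟩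
      · show σ (-(σ z * ((ϖ * σ ϖ) ^ j)⁻¹ * z)) = -(σ z * ((ϖ * σ ϖ) ^ j)⁻¹ * z)
        rw [map_neg, map_mul, map_mul, hσ, hd₁σ]; ring
      · show -(σ z * ((ϖ * σ ϖ) ^ j)⁻¹ * z) ≠ 0
        exact neg_ne_zero.2 (mul_ne_zero (mul_ne_zero ((map_ne_zero σ).2 hz0) hd₁0) hz0)
    · exact ⟨hd₁σ, hd₁0⟩
  have hV₁ := isVertexLattice_two_latt_axis1 hvσ hϖ hz j
  -- one `S_F`-coset of type-2 polarisations (★ B9-0₂), hence `kappaCount = cosetKappa (D₁·S_F)`, evaluated by the dichotomy (★ Fκ2)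
  rw [kappaCount_eq_cosetKappa_of_hcoset σ ϖ 2 i _ hD₁ hV₁
      (isVertexLattice_diagonal_iff_of_unique σ hV₁ (fun D hD hV => typeTwoPolarisation_unique_latt_axis1 hvσ hfix hϖ hz _ D hD₁ hV₁ hD hV)),
    cosetKappa_coset_eq_of_dichotomy σ hσc hc hdich i _ hD₁]
  -- the fixed-unit stabiliser: `u ∈ S_F ↔ u ∈ 𝒰^σ ∧ |u_2 − u_1| ≤ |ϖ^s|`
  have hSF := fun u => mem_fixedUnitStabilizer_latt_axis1_iff σ hϖ0 hz (2 * j + 1) u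
  by_cases hi : i = 0
  · subst hi
    by_cases hds : 2 * d ≤ 2 * j + 1 + 1
    · -- ALIVE (`2d − 1 ≤ s`): deep fixed one-units are norms, so `ω` is constant on each class `u_2 ≡ u_1 (ϖ^s)`
      have hall : ∀ u ∈ fixedUnitStabilizer σ (latt (!![1, 0, 0; 0, 1, 0; 0, z, ϖ ^ (2 * j + 1)] : Matrix (Fin 3) (Fin 3) K)),
          chiVec σ 0 (fun k => ((u k : Kˣ) : K)) = 1 := by
        intro u hu
        obtain ⟨huT, hab⟩ := (hSF u).1 hu
        obtain ⟨huv, huσ⟩ := (mem_fixedUnitTorus_iff σ u).1 huT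
        have hle : Valued.v (((u 1 : Kˣ) : K) - (u 2 : Kˣ)) ≤ Valued.v ϖ ^ (2 * j + 1) := by
          rw [Valuation.map_sub_swap, ← map_pow]; exact hab
        rw [chiVec_zero]
        show normSign σ ((u 1 : Kˣ) : K) * normSign σ ((u 2 : Kˣ) : K) = 1
        rw [normSign_eq_of_near hD (huσ 1) (huσ 2) (huv 1) (n := 2 * j + 1) (by omega) hle, normSign_mul_self]
      rw [if_pos hall, if_pos (show (0 : Fin 3) = 0 ∧ 2 * d ≤ 2 * j + 1 + 1 from ⟨rfl, hds⟩), chiVec_zero]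
      show normSign σ (-(σ z * ((ϖ * σ ϖ) ^ j)⁻¹ * z)) * normSign σ (((ϖ * σ ϖ) ^ j)⁻¹) = normSign σ (-1)
      rw [normSign_neg_polarisation_entry hϖ0 hz0 j, normSign_normVarpi_pow_inv hϖ0 j, mul_one]
    · -- DEAD FOOT (`s + 3 ≤ 2d`): the level-`(j+1)` non-norm `u₀` (`|u₀ − 1| ≤ |ϖ|^(2j+2) ≤ |ϖ|^s`) sits in `S_F` at the foot's partner slot with `χ = ω(u₀) = −1`
      obtain ⟨u₀, hσu₀, hu₀1, hu₀, hu₀n⟩ := exists_fixed_unit_not_norm_of_level_pow σ ϖ d t hD (n := j + 1) (by omega)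
      have hu₀0 : u₀ ≠ 0 := fun h => by rw [h, map_zero] at hu₀1; exact zero_ne_one hu₀1
      have hu₀' : Valued.v (u₀ - 1) ≤ Valued.v (ϖ ^ (2 * j + 1)) := by
        refine hu₀.trans ?_
        rw [map_pow, map_pow]
        exact pow_le_pow_right_of_le_one' hϖ1 (by omega)
      have hnall : ¬ ∀ u ∈ fixedUnitStabilizer σ (latt (!![1, 0, 0; 0, 1, 0; 0, z, ϖ ^ (2 * j + 1)] : Matrix (Fin 3) (Fin 3) K)),
          chiVec σ 0 (fun k => ((u k : Kˣ) : K)) = 1 := by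
        intro hall
        have hmem : (![1, 1, Units.mk0 u₀ hu₀0] : Fin 3 → Kˣ) ∈ fixedUnitStabilizer σ (latt (!![1, 0, 0; 0, 1, 0; 0, z, ϖ ^ (2 * j + 1)] : Matrix (Fin 3) (Fin 3) K)) := by
          refine (hSF _).2 ⟨(mem_fixedUnitTorus_iff σ _).2 ⟨fun k => ?_, fun k => ?_⟩, ?_⟩
          · fin_cases k <;> simp [hu₀1]
          · fin_cases k <;> simp [hσu₀]
          · simpa using hu₀'
        have h : normSign σ ((1 : Kˣ) : K) * normSign σ ((Units.mk0 u₀ hu₀0 : Kˣ) : K) = 1 := hall _ hmem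
        rw [Units.val_one, Units.val_mk0, normSign_one, normSign_of_not_isNorm σ hu₀n] at h
        norm_num at h
      rw [if_neg hnall, if_neg (fun h => hds h.2)]
  · -- DEAD OFF-FOOT: the non-norm `c` in an off-foot slot is in `S_F` and flips both off-foot characters
    have hnall : ¬ ∀ u ∈ fixedUnitStabilizer σ (latt (!![1, 0, 0; 0, 1, 0; 0, z, ϖ ^ (2 * j + 1)] : Matrix (Fin 3) (Fin 3) K)),
        chiVec σ i (fun k => ((u k : Kˣ) : K)) = 1 := by
      intro hall
      have hmem : (![Units.mk0 c hc0, 1, 1] : Fin 3 → Kˣ) ∈ fixedUnitStabilizer σ (latt (!![1, 0, 0; 0, 1, 0; 0, z, ϖ ^ (2 * j + 1)] : Matrix (Fin 3) (Fin 3) K)) := by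
        refine (hSF _).2 ⟨(mem_fixedUnitTorus_iff σ _).2 ⟨fun k => ?_, fun k => ?_⟩, ?_⟩
        · fin_cases k <;> simp [hcv]
        · fin_cases k <;> simp [hσc]
        · simp
      have hωc := normSign_of_not_isNorm σ hc
      obtain rfl | rfl : i = 1 ∨ i = 2 := by
        fin_cases i
        · exact absurd rfl hi
        · exact Or.inl rfl
        · exact Or.inr rfl
      · have h : normSign σ ((Units.mk0 c hc0 : Kˣ) : K) * normSign σ ((1 : Kˣ) : K) = 1 := hall _ hmem
        rw [Units.val_one, Units.val_mk0, normSign_one, hωc] at h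
        norm_num at h
      · have h : normSign σ ((Units.mk0 c hc0 : Kˣ) : K) * normSign σ ((1 : Kˣ) : K) = 1 := hall _ hmem
        rw [Units.val_one, Units.val_mk0, normSign_one, hωc] at h
        norm_num at h
    rw [if_neg hnall, if_neg (fun h => hi h.1)]

/-- **AXIS 2 (plane `⟨e₀,e₂⟩`, foot index `1`), TYPE 2**: for `|y| = 1` and ODD `s`, `kappaCount σ ϖ 2 i (M₂(s,y)) = ω(−1)` if `i = 1 ∧ 2d ≤ s + 1`, and `0` otherwise
(one `S_F`-coset ★ B9-0₂; ALIVE by deep norms at F-level `(s+1)∕2 ≥ d`, DEAD FOOT by the level-`(s+1)∕2` non-norm, DEAD OFF-FOOT by the non-norm `c` in an off-foot slot).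
[cite: Kottwitz1986BaseChangeUnits, §1 pp. 240–241] [cite: Serre1979, Ch. V §3 Prop. 5, Cor. 3] [cite: Rogawski1990, §4.10 p. 58] -/
theorem kappaCount_two_latt_axis2 [CompleteSpace K] [Finite 𝓀[K]] {σ : K →+* K} {ϖ : K} {d t : ℕ} (hD : IsRamifiedQuadraticDatum σ ϖ d t)
    {y : K} (hy : Valued.v y = 1) {s : ℕ} (hs : ¬ 2 ∣ s) (i : Fin 3) :
    kappaCount σ ϖ 2 i (latt (!![1, 0, 0; 0, 1, 0; y, 0, ϖ ^ s] : Matrix (Fin 3) (Fin 3) K)) = if i = 1 ∧ 2 * d ≤ s + 1 then normSign σ (-1 : K) else 0 := by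
  have hD' := hD
  obtain ⟨hσ, hvσ, hϖ, hfix, -, -, -⟩ := hD'
  haveI : IsAdicComplete 𝓂[K] 𝒪[K] := isAdicComplete_valuedInteger_of_completeSpace hϖ
  obtain ⟨c, hσc, hcv, hc, hdich⟩ := exists_nonnorm_dichotomy_of_isRamifiedQuadraticDatum σ ϖ d t hD
  obtain ⟨j, rfl⟩ : ∃ j, s = 2 * j + 1 := ⟨s / 2, by omega⟩
  have hϖ0 : ϖ ≠ 0 := fun h0 => by rw [h0, map_zero] at hϖ; exact WithZero.coe_ne_zero hϖ.symm
  have hϖ1 : Valued.v ϖ ≤ 1 := by rw [hϖ, ← WithZero.exp_zero, WithZero.exp_le_exp]; norm_num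
  have hσϖ0 : σ ϖ ≠ 0 := (map_ne_zero σ).2 hϖ0
  have hy0 : y ≠ 0 := fun h => by rw [h, map_zero] at hy; exact zero_ne_one hy
  have hc0 : c ≠ 0 := fun h => by rw [h, map_zero] at hcv; exact zero_ne_one hcv
  have hπ₀σ : σ (ϖ * σ ϖ) = ϖ * σ ϖ := by rw [map_mul, hσ, mul_comm]
  have hd₁σ : σ (((ϖ * σ ϖ) ^ j)⁻¹) = ((ϖ * σ ϖ) ^ j)⁻¹ := by rw [map_inv₀, map_pow, hπ₀σ]
  have hd₁0 : (((ϖ * σ ϖ) ^ j)⁻¹ : K) ≠ 0 := inv_ne_zero (pow_ne_zero _ (mul_ne_zero hϖ0 hσϖ0))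
  have hD₁ : ∀ k : Fin 3, σ ((![-(σ y * ((ϖ * σ ϖ) ^ j)⁻¹ * y), 1, ((ϖ * σ ϖ) ^ j)⁻¹] : Fin 3 → K) k) = (![-(σ y * ((ϖ * σ ϖ) ^ j)⁻¹ * y), 1, ((ϖ * σ ϖ) ^ j)⁻¹] : Fin 3 → K) k ∧ (![-(σ y * ((ϖ * σ ϖ) ^ j)⁻¹ * y), 1, ((ϖ * σ ϖ) ^ j)⁻¹] : Fin 3 → K) k ≠ 0 := by
    intro k
    fin_cases k
    · refine ⟨?_, ?_⟩
      · show σ (-(σ y * ((ϖ * σ ϖ) ^ j)⁻¹ * y)) = -(σ y * ((ϖ * σ ϖ) ^ j)⁻¹ * y)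
        rw [map_neg, map_mul, map_mul, hσ, hd₁σ]; ring
      · show -(σ y * ((ϖ * σ ϖ) ^ j)⁻¹ * y) ≠ 0
        exact neg_ne_zero.2 (mul_ne_zero (mul_ne_zero ((map_ne_zero σ).2 hy0) hd₁0) hy0)
    · exact ⟨map_one σ, one_ne_zero⟩
    · exact ⟨hd₁σ, hd₁0⟩
  have hV₁ := isVertexLattice_two_latt_axis2 hvσ hϖ hy j
  -- one `S_F`-coset of type-2 polarisations (★ B9-0₂), hence `kappaCount = cosetKappa (D₁·S_F)`, evaluated by the dichotomy (★ Fκ2)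
  rw [kappaCount_eq_cosetKappa_of_hcoset σ ϖ 2 i _ hD₁ hV₁
      (isVertexLattice_diagonal_iff_of_unique σ hV₁ (fun D hD hV => typeTwoPolarisation_unique_latt_axis2 hvσ hfix hϖ hy _ D hD₁ hV₁ hD hV)),
    cosetKappa_coset_eq_of_dichotomy σ hσc hc hdich i _ hD₁]
  -- the fixed-unit stabiliser: `u ∈ S_F ↔ u ∈ 𝒰^σ ∧ |u_2 − u_0| ≤ |ϖ^s|`
  have hSF := fun u => mem_fixedUnitStabilizer_latt_axis2_iff σ hϖ0 hy (2 * j + 1) u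
  by_cases hi : i = 1
  · subst hi
    by_cases hds : 2 * d ≤ 2 * j + 1 + 1
    · -- ALIVE (`2d − 1 ≤ s`): deep fixed one-units are norms, so `ω` is constant on each class `u_2 ≡ u_0 (ϖ^s)`
      have hall : ∀ u ∈ fixedUnitStabilizer σ (latt (!![1, 0, 0; 0, 1, 0; y, 0, ϖ ^ (2 * j + 1)] : Matrix (Fin 3) (Fin 3) K)),
          chiVec σ 1 (fun k => ((u k : Kˣ) : K)) = 1 := by
        intro u hu
        obtain ⟨huT, hab⟩ := (hSF u).1 hu
        obtain ⟨huv, huσ⟩ := (mem_fixedUnitTorus_iff σ u).1 huT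
        have hle : Valued.v (((u 0 : Kˣ) : K) - (u 2 : Kˣ)) ≤ Valued.v ϖ ^ (2 * j + 1) := by
          rw [Valuation.map_sub_swap, ← map_pow]; exact hab
        rw [chiVec_one]
        show normSign σ ((u 0 : Kˣ) : K) * normSign σ ((u 2 : Kˣ) : K) = 1
        rw [normSign_eq_of_near hD (huσ 0) (huσ 2) (huv 0) (n := 2 * j + 1) (by omega) hle, normSign_mul_self]
      rw [if_pos hall, if_pos (show (1 : Fin 3) = 1 ∧ 2 * d ≤ 2 * j + 1 + 1 from ⟨rfl, hds⟩), chiVec_one]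
      show normSign σ (-(σ y * ((ϖ * σ ϖ) ^ j)⁻¹ * y)) * normSign σ (((ϖ * σ ϖ) ^ j)⁻¹) = normSign σ (-1)
      rw [normSign_neg_polarisation_entry hϖ0 hy0 j, normSign_normVarpi_pow_inv hϖ0 j, mul_one]
    · -- DEAD FOOT (`s + 3 ≤ 2d`): the level-`(j+1)` non-norm `u₀` (`|u₀ − 1| ≤ |ϖ|^(2j+2) ≤ |ϖ|^s`) sits in `S_F` at the foot's partner slot with `χ = ω(u₀) = −1`
      obtain ⟨u₀, hσu₀, hu₀1, hu₀, hu₀n⟩ := exists_fixed_unit_not_norm_of_level_pow σ ϖ d t hD (n := j + 1) (by omega)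
      have hu₀0 : u₀ ≠ 0 := fun h => by rw [h, map_zero] at hu₀1; exact zero_ne_one hu₀1
      have hu₀' : Valued.v (u₀ - 1) ≤ Valued.v (ϖ ^ (2 * j + 1)) := by
        refine hu₀.trans ?_
        rw [map_pow, map_pow]
        exact pow_le_pow_right_of_le_one' hϖ1 (by omega)
      have hnall : ¬ ∀ u ∈ fixedUnitStabilizer σ (latt (!![1, 0, 0; 0, 1, 0; y, 0, ϖ ^ (2 * j + 1)] : Matrix (Fin 3) (Fin 3) K)),
          chiVec σ 1 (fun k => ((u k : Kˣ) : K)) = 1 := by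
        intro hall
        have hmem : (![1, 1, Units.mk0 u₀ hu₀0] : Fin 3 → Kˣ) ∈ fixedUnitStabilizer σ (latt (!![1, 0, 0; 0, 1, 0; y, 0, ϖ ^ (2 * j + 1)] : Matrix (Fin 3) (Fin 3) K)) := by
          refine (hSF _).2 ⟨(mem_fixedUnitTorus_iff σ _).2 ⟨fun k => ?_, fun k => ?_⟩, ?_⟩
          · fin_cases k <;> simp [hu₀1]
          · fin_cases k <;> simp [hσu₀]
          · simpa using hu₀'
        have h : normSign σ ((1 : Kˣ) : K) * normSign σ ((Units.mk0 u₀ hu₀0 : Kˣ) : K) = 1 := hall _ hmem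
        rw [Units.val_one, Units.val_mk0, normSign_one, normSign_of_not_isNorm σ hu₀n] at h
        norm_num at h
      rw [if_neg hnall, if_neg (fun h => hds h.2)]
  · -- DEAD OFF-FOOT: the non-norm `c` in an off-foot slot is in `S_F` and flips both off-foot characters
    have hnall : ¬ ∀ u ∈ fixedUnitStabilizer σ (latt (!![1, 0, 0; 0, 1, 0; y, 0, ϖ ^ (2 * j + 1)] : Matrix (Fin 3) (Fin 3) K)),
        chiVec σ i (fun k => ((u k : Kˣ) : K)) = 1 := by
      intro hall
      have hmem : (![1, Units.mk0 c hc0, 1] : Fin 3 → Kˣ) ∈ fixedUnitStabilizer σ (latt (!![1, 0, 0; 0, 1, 0; y, 0, ϖ ^ (2 * j + 1)] : Matrix (Fin 3) (Fin 3) K)) := by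
        refine (hSF _).2 ⟨(mem_fixedUnitTorus_iff σ _).2 ⟨fun k => ?_, fun k => ?_⟩, ?_⟩
        · fin_cases k <;> simp [hcv]
        · fin_cases k <;> simp [hσc]
        · simp
      have hωc := normSign_of_not_isNorm σ hc
      obtain rfl | rfl : i = 0 ∨ i = 2 := by
        fin_cases i
        · exact Or.inl rfl
        · exact absurd rfl hi
        · exact Or.inr rfl
      · have h : normSign σ ((Units.mk0 c hc0 : Kˣ) : K) * normSign σ ((1 : Kˣ) : K) = 1 := hall _ hmem
        rw [Units.val_one, Units.val_mk0, normSign_one, hωc] at h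
        norm_num at h
      · have h : normSign σ ((1 : Kˣ) : K) * normSign σ ((Units.mk0 c hc0 : Kˣ) : K) = 1 := hall _ hmem
        rw [Units.val_one, Units.val_mk0, normSign_one, hωc] at h
        norm_num at h
    rw [if_neg hnall, if_neg (fun h => hi h.1)]

/-- **AXIS 3 (plane `⟨e₀,e₁⟩`, foot index `2`), TYPE 2**: for `|x| = 1` and ODD `s`, `kappaCount σ ϖ 2 i (M₃(s,x)) = ω(−1)` if `i = 2 ∧ 2d ≤ s + 1`, and `0` otherwise
(one `S_F`-coset ★ B9-0₂; ALIVE by deep norms at F-level `(s+1)∕2 ≥ d`, DEAD FOOT by the level-`(s+1)∕2` non-norm, DEAD OFF-FOOT by the non-norm `c` in an off-foot slot).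
[cite: Kottwitz1986BaseChangeUnits, §1 pp. 240–241] [cite: Serre1979, Ch. V §3 Prop. 5, Cor. 3] [cite: Rogawski1990, §4.10 p. 58] -/
theorem kappaCount_two_latt_axis3 [CompleteSpace K] [Finite 𝓀[K]] {σ : K →+* K} {ϖ : K} {d t : ℕ} (hD : IsRamifiedQuadraticDatum σ ϖ d t)
    {x : K} (hx : Valued.v x = 1) {s : ℕ} (hs : ¬ 2 ∣ s) (i : Fin 3) :
    kappaCount σ ϖ 2 i (latt (!![1, 0, 0; x, ϖ ^ s, 0; 0, 0, 1] : Matrix (Fin 3) (Fin 3) K)) = if i = 2 ∧ 2 * d ≤ s + 1 then normSign σ (-1 : K) else 0 := by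
  have hD' := hD
  obtain ⟨hσ, hvσ, hϖ, hfix, -, -, -⟩ := hD'
  haveI : IsAdicComplete 𝓂[K] 𝒪[K] := isAdicComplete_valuedInteger_of_completeSpace hϖ
  obtain ⟨c, hσc, hcv, hc, hdich⟩ := exists_nonnorm_dichotomy_of_isRamifiedQuadraticDatum σ ϖ d t hD
  obtain ⟨j, rfl⟩ : ∃ j, s = 2 * j + 1 := ⟨s / 2, by omega⟩
  have hϖ0 : ϖ ≠ 0 := fun h0 => by rw [h0, map_zero] at hϖ; exact WithZero.coe_ne_zero hϖ.symm
  have hϖ1 : Valued.v ϖ ≤ 1 := by rw [hϖ, ← WithZero.exp_zero, WithZero.exp_le_exp]; norm_num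
  have hσϖ0 : σ ϖ ≠ 0 := (map_ne_zero σ).2 hϖ0
  have hx0 : x ≠ 0 := fun h => by rw [h, map_zero] at hx; exact zero_ne_one hx
  have hc0 : c ≠ 0 := fun h => by rw [h, map_zero] at hcv; exact zero_ne_one hcv
  have hπ₀σ : σ (ϖ * σ ϖ) = ϖ * σ ϖ := by rw [map_mul, hσ, mul_comm]
  have hd₁σ : σ (((ϖ * σ ϖ) ^ j)⁻¹) = ((ϖ * σ ϖ) ^ j)⁻¹ := by rw [map_inv₀, map_pow, hπ₀σ]
  have hd₁0 : (((ϖ * σ ϖ) ^ j)⁻¹ : K) ≠ 0 := inv_ne_zero (pow_ne_zero _ (mul_ne_zero hϖ0 hσϖ0))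
  have hD₁ : ∀ k : Fin 3, σ ((![-(σ x * ((ϖ * σ ϖ) ^ j)⁻¹ * x), ((ϖ * σ ϖ) ^ j)⁻¹, 1] : Fin 3 → K) k) = (![-(σ x * ((ϖ * σ ϖ) ^ j)⁻¹ * x), ((ϖ * σ ϖ) ^ j)⁻¹, 1] : Fin 3 → K) k ∧ (![-(σ x * ((ϖ * σ ϖ) ^ j)⁻¹ * x), ((ϖ * σ ϖ) ^ j)⁻¹, 1] : Fin 3 → K) k ≠ 0 := by
    intro k
    fin_cases k
    · refine ⟨?_, ?_⟩
      · show σ (-(σ x * ((ϖ * σ ϖ) ^ j)⁻¹ * x)) = -(σ x * ((ϖ * σ ϖ) ^ j)⁻¹ * x)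
        rw [map_neg, map_mul, map_mul, hσ, hd₁σ]; ring
      · show -(σ x * ((ϖ * σ ϖ) ^ j)⁻¹ * x) ≠ 0
        exact neg_ne_zero.2 (mul_ne_zero (mul_ne_zero ((map_ne_zero σ).2 hx0) hd₁0) hx0)
    · exact ⟨hd₁σ, hd₁0⟩
    · exact ⟨map_one σ, one_ne_zero⟩
  have hV₁ := isVertexLattice_two_latt_axis3 hvσ hϖ hx j
  -- one `S_F`-coset of type-2 polarisations (★ B9-0₂), hence `kappaCount = cosetKappa (D₁·S_F)`, evaluated by the dichotomy (★ Fκ2)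
  rw [kappaCount_eq_cosetKappa_of_hcoset σ ϖ 2 i _ hD₁ hV₁
      (isVertexLattice_diagonal_iff_of_unique σ hV₁ (fun D hD hV => typeTwoPolarisation_unique_latt_axis3 hvσ hfix hϖ hx _ D hD₁ hV₁ hD hV)),
    cosetKappa_coset_eq_of_dichotomy σ hσc hc hdich i _ hD₁]
  -- the fixed-unit stabiliser: `u ∈ S_F ↔ u ∈ 𝒰^σ ∧ |u_1 − u_0| ≤ |ϖ^s|`
  have hSF := fun u => mem_fixedUnitStabilizer_latt_axis3_iff σ hϖ0 hx (2 * j + 1) u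
  by_cases hi : i = 2
  · subst hi
    by_cases hds : 2 * d ≤ 2 * j + 1 + 1
    · -- ALIVE (`2d − 1 ≤ s`): deep fixed one-units are norms, so `ω` is constant on each class `u_1 ≡ u_0 (ϖ^s)`
      have hall : ∀ u ∈ fixedUnitStabilizer σ (latt (!![1, 0, 0; x, ϖ ^ (2 * j + 1), 0; 0, 0, 1] : Matrix (Fin 3) (Fin 3) K)),
          chiVec σ 2 (fun k => ((u k : Kˣ) : K)) = 1 := by
        intro u hu
        obtain ⟨huT, hab⟩ := (hSF u).1 hu
        obtain ⟨huv, huσ⟩ := (mem_fixedUnitTorus_iff σ u).1 huT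
        have hle : Valued.v (((u 0 : Kˣ) : K) - (u 1 : Kˣ)) ≤ Valued.v ϖ ^ (2 * j + 1) := by
          rw [Valuation.map_sub_swap, ← map_pow]; exact hab
        rw [chiVec_two]
        show normSign σ ((u 0 : Kˣ) : K) * normSign σ ((u 1 : Kˣ) : K) = 1
        rw [normSign_eq_of_near hD (huσ 0) (huσ 1) (huv 0) (n := 2 * j + 1) (by omega) hle, normSign_mul_self]
      rw [if_pos hall, if_pos (show (2 : Fin 3) = 2 ∧ 2 * d ≤ 2 * j + 1 + 1 from ⟨rfl, hds⟩), chiVec_two]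
      show normSign σ (-(σ x * ((ϖ * σ ϖ) ^ j)⁻¹ * x)) * normSign σ (((ϖ * σ ϖ) ^ j)⁻¹) = normSign σ (-1)
      rw [normSign_neg_polarisation_entry hϖ0 hx0 j, normSign_normVarpi_pow_inv hϖ0 j, mul_one]
    · -- DEAD FOOT (`s + 3 ≤ 2d`): the level-`(j+1)` non-norm `u₀` (`|u₀ − 1| ≤ |ϖ|^(2j+2) ≤ |ϖ|^s`) sits in `S_F` at the foot's partner slot with `χ = ω(u₀) = −1`
      obtain ⟨u₀, hσu₀, hu₀1, hu₀, hu₀n⟩ := exists_fixed_unit_not_norm_of_level_pow σ ϖ d t hD (n := j + 1) (by omega)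
      have hu₀0 : u₀ ≠ 0 := fun h => by rw [h, map_zero] at hu₀1; exact zero_ne_one hu₀1
      have hu₀' : Valued.v (u₀ - 1) ≤ Valued.v (ϖ ^ (2 * j + 1)) := by
        refine hu₀.trans ?_
        rw [map_pow, map_pow]
        exact pow_le_pow_right_of_le_one' hϖ1 (by omega)
      have hnall : ¬ ∀ u ∈ fixedUnitStabilizer σ (latt (!![1, 0, 0; x, ϖ ^ (2 * j + 1), 0; 0, 0, 1] : Matrix (Fin 3) (Fin 3) K)),
          chiVec σ 2 (fun k => ((u k : Kˣ) : K)) = 1 := by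
        intro hall
        have hmem : (![1, Units.mk0 u₀ hu₀0, 1] : Fin 3 → Kˣ) ∈ fixedUnitStabilizer σ (latt (!![1, 0, 0; x, ϖ ^ (2 * j + 1), 0; 0, 0, 1] : Matrix (Fin 3) (Fin 3) K)) := by
          refine (hSF _).2 ⟨(mem_fixedUnitTorus_iff σ _).2 ⟨fun k => ?_, fun k => ?_⟩, ?_⟩
          · fin_cases k <;> simp [hu₀1]
          · fin_cases k <;> simp [hσu₀]
          · simpa using hu₀'
        have h : normSign σ ((1 : Kˣ) : K) * normSign σ ((Units.mk0 u₀ hu₀0 : Kˣ) : K) = 1 := hall _ hmem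
        rw [Units.val_one, Units.val_mk0, normSign_one, normSign_of_not_isNorm σ hu₀n] at h
        norm_num at h
      rw [if_neg hnall, if_neg (fun h => hds h.2)]
  · -- DEAD OFF-FOOT: the non-norm `c` in an off-foot slot is in `S_F` and flips both off-foot characters
    have hnall : ¬ ∀ u ∈ fixedUnitStabilizer σ (latt (!![1, 0, 0; x, ϖ ^ (2 * j + 1), 0; 0, 0, 1] : Matrix (Fin 3) (Fin 3) K)),
        chiVec σ i (fun k => ((u k : Kˣ) : K)) = 1 := by
      intro hall
      have hmem : (![1, 1, Units.mk0 c hc0] : Fin 3 → Kˣ) ∈ fixedUnitStabilizer σ (latt (!![1, 0, 0; x, ϖ ^ (2 * j + 1), 0; 0, 0, 1] : Matrix (Fin 3) (Fin 3) K)) := by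
        refine (hSF _).2 ⟨(mem_fixedUnitTorus_iff σ _).2 ⟨fun k => ?_, fun k => ?_⟩, ?_⟩
        · fin_cases k <;> simp [hcv]
        · fin_cases k <;> simp [hσc]
        · simp
      have hωc := normSign_of_not_isNorm σ hc
      obtain rfl | rfl : i = 0 ∨ i = 1 := by
        fin_cases i
        · exact Or.inl rfl
        · exact Or.inr rfl
        · exact absurd rfl hi
      · have h : normSign σ ((1 : Kˣ) : K) * normSign σ ((Units.mk0 c hc0 : Kˣ) : K) = 1 := hall _ hmem
        rw [Units.val_one, Units.val_mk0, normSign_one, hωc] at h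
        norm_num at h
      · have h : normSign σ ((1 : Kˣ) : K) * normSign σ ((Units.mk0 c hc0 : Kˣ) : K) = 1 := hall _ hmem
        rw [Units.val_one, Units.val_mk0, normSign_one, hωc] at h
        norm_num at h
    rw [if_neg hnall, if_neg (fun h => hi h.1)]

end Summit.HodgeConjecture.HodgeConjecture.Cruxes.H413.F0P3cDyRamDiagonalKappaSplitCountTwoValues

end
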